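import Literature.Topology.FourManifolds.SurfaceGroupNielsenSetup
import Literature.GroupTheory.CombinatorialGroupTheory.QuadraticWordsEngine
import HarnessLib

/-!
# Nielsen's theorem, pillar CORE (homotopic shortening): the minimal-counterexample frame

Topic `Literature/Topology/FourManifolds`.  Zieschang proves the homotopic shortening theorem
(Zieschang–Vogt–Coldewey, LNM 835, Thm. 5.2.6, Thm. 5.3.2, Lemma 5.3.4, Cor. 5.3.5) by nested
terminating processes (Nielsen reduction of the factors; elimination of separated pairs by
bifurcations; shortening along a separated chain).  We recast it as a MINIMAL COUNTEREXAMPLE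
argument.  A *configuration* for an assignment `φ` of the symbols in `S_g` is a binary product
related to the canonical one together with a lift of its (transformed) values:

* `Config φ` — a permutation `w` of the surface word, a marking `θ` up to conjugacy
  (`θ (mk w) = c r c⁻¹`; the tree's transport moves `exists_move_absorb_right/left` produce
  exactly such markings) and a lift `Y` of the transformed assignment
  (`proj (Y i) = φ̂ (θ xᵢ)`);
* its *value* `Ŷ(mk w)`, its *closed-path length* `ell` (length of the cyclic reduction of the
  value; a conjugacy invariant), its *measure* `zM` (Zieschang's `zMeasure` of the lift after
  relabelling the symbols by `Fin (2g)·…`), and the lexicographic *potential* `pot = (ell, zM)`;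
* `Config.ofLift` — every lift of `φ` is a configuration (canonical word, trivial marking);
  `Config.pullback` — every configuration pulls back to a lift of `φ` whose boundary word is
  conjugate to the value (`lift_pullback_surfaceRelator`);
* `Config.IsMin` and `Config.exists_isMin` — a potential-minimal configuration exists;
* `NoDoublePoint g` — *"the cyclically reduced value of a minimal configuration of an
  indecomposable, marked non-trivial assignment is a simple circuit"* — and the reduction
  `homotopicSimple_of_noDoublePoint : NoDoublePoint g → (rotation lemma) → HomotopicSimple g`.

So `HomotopicSimple` (the CORE pillar of `SurfaceGroupNielsenSetup.lean`) is reduced to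
`NoDoublePoint`, which is attacked in the sibling files by the chain/surgery machinery of
`BinaryProductKernels/Tiling/Chains/Surgery.lean` along the case analysis recorded in the crux
notes (no separated chain by surgery; no doubly half-cancelled symbol by the Lyndon–Schupp weight;
non-portal symbols are not separated; junction/portal cuts by per-level parity).

## References

* H. Zieschang, E. Vogt, H.-D. Coldewey, *Surfaces and Planar Discontinuous Groups*, LNM 835
  (1980), §5.2 (Thm. 5.2.6), §5.3 (5.3.1–5.3.5). [ZieschangVogtColdewey1980]
* H. Zieschang, *Alternierende Produkte in freien Gruppen II*, Abh. Math. Sem. Univ. Hamburg 28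
  (1965) 219–233. [Zieschang1965]
-/

noncomputable section

namespace Literature.Topology.FourManifolds

open Literature.GroupTheory.CombinatorialGroupTheory List

namespace SurfaceGroup

variable {g : ℕ}

/-! ## Configurations -/

/-- **Configuration** of the homotopic shortening for an assignment `φ` of the symbols in `S_g`
(ZVC 5.3.1: a binary product related to the canonical one, with a choice of representatives of
its factors): a permutation `w` of the surface word, a marking `θ` of `w` up to conjugacy, and a
lift `Y` of the transformed assignment. [cite: ZieschangVogtColdewey1980, 5.3.1] -/
structure Config (φ : surfaceGen g → SurfaceGroup g) where
  /-- the quadratic word (a permutation of the letters of the surface word) -/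
  w : List (surfaceGen g × Bool)
  /-- the marking: an automorphism carrying `w` to a conjugate of the relator -/
  θ : FreeGroup (surfaceGen g) ≃* FreeGroup (surfaceGen g)
  /-- the conjugator of the marking -/
  c : FreeGroup (surfaceGen g)
  /-- the lift of the transformed assignment -/
  Y : surfaceGen g → FreeGroup (surfaceGen g)
  /-- `w` is a permutation of the surface word -/
  perm : w ~ surfaceWordStd g
  /-- `θ (mk w) = c r c⁻¹` -/
  marking : θ (FreeGroup.mk w) = c * surfaceRelator g * c⁻¹
  /-- `Y` lifts the transformed assignment `φ̂ ∘ θ` -/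
  lift : ∀ i, proj g (Y i) = FreeGroup.lift φ (θ (FreeGroup.of i))

namespace Config

variable {φ : surfaceGen g → SurfaceGroup g}

/-- The **value** of a configuration: `Ŷ (mk w)`. [cite: ZieschangVogtColdewey1980, 5.2.1] -/
def value (κ : Config φ) : FreeGroup (surfaceGen g) := FreeGroup.lift κ.Y (FreeGroup.mk κ.w)

/-- The **closed-path length**: the length of the cyclically reduced value (ZVC 5.3.2: *"The
length of a binary product is defined to be the length of the cyclically reduced path"*).
[cite: ZieschangVogtColdewey1980, Thm. 5.3.2] -/
def ell (κ : Config φ) : ℕ := (FreeGroup.reduceCyclically (FreeGroup.toWord κ.value)).length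

/-- Relabelling of the symbols by a finite ordinal (for Zieschang's measure). [folklore] -/
def relabel (g : ℕ) : FreeGroup (surfaceGen g) ≃* FreeGroup (Fin (Fintype.card (surfaceGen g))) :=
  FreeGroup.freeGroupCongr (Fintype.equivFin (surfaceGen g))

/-- **Zieschang's measure** of the lift (total length, then total left-half weight) after
relabelling. [cite: ZieschangVogtColdewey1980, Thm. 5.2.6] -/
def zM (κ : Config φ) : Lex (ℕ × ℕ) := zMeasure fun i => relabel g (κ.Y i)

/-- The **potential**: closed-path length first, then Zieschang's measure. [folklore] -/
def pot (κ : Config φ) : Lex (ℕ × Lex (ℕ × ℕ)) := toLex (κ.ell, κ.zM)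

/-- A **minimal configuration**: no configuration has smaller potential. [folklore] -/
def IsMin (κ : Config φ) : Prop := ∀ κ' : Config φ, ¬ κ'.pot < κ.pot

/-- **The configuration of a lift** of `φ`: canonical word, trivial marking.
[cite: ZieschangVogtColdewey1980, 5.3.1] -/
def ofLift (X : surfaceGen g → FreeGroup (surfaceGen g)) (hX : ∀ i, proj g (X i) = φ i) : Config φ where
  w := surfaceWordStd g
  θ := MulEquiv.refl _
  c := 1
  Y := X
  perm := List.Perm.refl _
  marking := by simp [mk_surfaceWordStd]
  lift i := by simp [hX i]

/-- **A minimal configuration exists** as soon as `φ` has a lift. [folklore] -/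
theorem exists_isMin (X : surfaceGen g → FreeGroup (surfaceGen g)) (hX : ∀ i, proj g (X i) = φ i) :
    ∃ κ : Config φ, κ.IsMin := by
  have hne : (Set.univ : Set (Config φ)).Nonempty := ⟨ofLift X hX, Set.mem_univ _⟩
  obtain ⟨κ, -, hκ⟩ := (InvImage.wf pot wellFounded_lt).has_min Set.univ hne
  exact ⟨κ, fun κ' h => hκ κ' (Set.mem_univ _) h⟩

/-! ## Pulling a configuration back to a lift of `φ` -/

/-- The lift `Ŷ` as a homomorphism composed with the marking computes the transformed values.
[folklore] -/
theorem proj_comp_lift (κ : Config φ) :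
    (proj g).comp (FreeGroup.lift κ.Y) = (FreeGroup.lift φ).comp κ.θ.toMonoidHom := by
  refine FreeGroup.ext_hom _ _ fun i => ?_
  simp [κ.lift i]

/-- **Pull-back**: the lift of `φ` represented by a configuration, `X i := Ŷ (θ⁻¹ xᵢ)`.
[cite: ZieschangVogtColdewey1980, proof of Thm. 5.3.2 ("reverse all bifurcations")] -/
def pullback (κ : Config φ) : surfaceGen g → FreeGroup (surfaceGen g) :=
  fun i => FreeGroup.lift κ.Y (κ.θ.symm (FreeGroup.of i))

/-- The pull-back is a lift of `φ`. [folklore] -/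
theorem proj_pullback (κ : Config φ) (i : surfaceGen g) : proj g (κ.pullback i) = φ i := by
  have h := DFunLike.congr_fun κ.proj_comp_lift (κ.θ.symm (FreeGroup.of i))
  simp only [MonoidHom.coe_comp, Function.comp_apply, MulEquiv.coe_toMonoidHom,
    MulEquiv.apply_symm_apply, FreeGroup.lift_apply_of] at h
  exact h

/-- The pull-back as a homomorphism is `Ŷ ∘ θ⁻¹`. [folklore] -/
theorem lift_pullback (κ : Config φ) :
    FreeGroup.lift κ.pullback = (FreeGroup.lift κ.Y).comp κ.θ.symm.toMonoidHom := by
  refine FreeGroup.ext_hom _ _ fun i => ?_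
  simp [pullback]

/-- **The boundary word of the pull-back is conjugate to the value.**
[cite: ZieschangVogtColdewey1980, proof of Thm. 5.3.2] -/
theorem lift_pullback_surfaceRelator (κ : Config φ) :
    ∃ d : FreeGroup (surfaceGen g), FreeGroup.lift κ.pullback (surfaceRelator g) = d * κ.value * d⁻¹ := by
  refine ⟨FreeGroup.lift κ.Y (κ.θ.symm κ.c)⁻¹, ?_⟩
  have hw : κ.θ.symm (surfaceRelator g) = (κ.θ.symm κ.c)⁻¹ * FreeGroup.mk κ.w * (κ.θ.symm κ.c)⁻¹⁻¹ := by
    have h := congrArg κ.θ.symm κ.marking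
    rw [MulEquiv.symm_apply_apply, map_mul, map_mul, map_inv] at h
    rw [h]
    group
  rw [lift_pullback, MonoidHom.comp_apply, MulEquiv.coe_toMonoidHom, hw]
  simp only [map_mul, map_inv, value]

/-! ## The reduction of the CORE pillar to minimal configurations -/

/-- **No double point** (the content of ZVC Thm. 5.3.2 + Cor. 5.3.5 in the minimal-counterexample
form): for an indecomposable, marked non-trivial assignment, the cyclically reduced value of a
potential-minimal configuration is a simple circuit. [cite: ZieschangVogtColdewey1980, Thm. 5.3.2, Cor. 5.3.5] -/
def _root_.Literature.Topology.FourManifolds.SurfaceGroup.NoDoublePoint (g : ℕ) : Prop :=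
  ∀ (φ : surfaceGen g → SurfaceGroup g), Indecomposable φ → MarkedNontrivial φ →
    ∀ κ : Config φ, κ.IsMin →
      IsSimpleCircuit (g := g) (FreeGroup.reduceCyclically (FreeGroup.toWord κ.value))

/-- **Rotation lemma** (cyclically reduced conjugates differ by a rotation), in the form needed
here: the cyclic reductions of two conjugate elements are rotations of each other. [folklore] -/
def _root_.Literature.Topology.FourManifolds.SurfaceGroup.CyclicReductionOfConj (g : ℕ) : Prop :=
  ∀ (x d : FreeGroup (surfaceGen g)), ∃ k : ℕ,
    FreeGroup.reduceCyclically (FreeGroup.toWord (d * x * d⁻¹)) =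
      (FreeGroup.reduceCyclically (FreeGroup.toWord x)).rotate k

/-- **Rotations of simple circuits are simple circuits.** [folklore] -/
def _root_.Literature.Topology.FourManifolds.SurfaceGroup.SimpleCircuitRotate (g : ℕ) : Prop :=
  ∀ (w : List (surfaceGen g × Bool)) (k : ℕ), IsSimpleCircuit (g := g) w → IsSimpleCircuit (g := g) (w.rotate k)

/-- **CORE from its frame**: if minimal configurations have no double point, then every
indecomposable marked non-trivial assignment has a homotopic lift with a simple boundary circuit
(`HomotopicSimple`): minimise the potential over all configurations and pull back.
[cite: ZieschangVogtColdewey1980, Thm. 5.3.2 and Cor. 5.3.5] -/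
theorem _root_.Literature.Topology.FourManifolds.SurfaceGroup.homotopicSimple_of_noDoublePoint
    (hN : NoDoublePoint g) (hR : CyclicReductionOfConj g) (hS : SimpleCircuitRotate g) :
    HomotopicSimple g := by
  intro φ hI hM X hX
  obtain ⟨κ, hκ⟩ := exists_isMin (φ := φ) X hX
  have hsimple := hN φ hI hM κ hκ
  refine ⟨κ.pullback, κ.proj_pullback, ?_⟩
  obtain ⟨d, hd⟩ := κ.lift_pullback_surfaceRelator
  obtain ⟨k, hk⟩ := hR κ.value d
  rw [hd, hk]
  exact hS _ k hsimple

end Config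

end SurfaceGroup

end Literature.Topology.FourManifolds

end
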